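import Literature.MathematicalPhysics.QuantumLattice.HubbardHoleCountingBound
import Literature.MathematicalPhysics.QuantumLattice.FreeFermionSectorEnergyDeviation
import Literature.MathematicalPhysics.QuantumLattice.TorusBandEdgeCounting
import Literature.MathematicalPhysics.QuantumLattice.HubbardLSMFillingProofs
import HarnessLib

/-!
# On-site repulsion raises the ground-state energy density of the 2D Hubbard torus near half filling

Topic `MathematicalPhysics/QuantumLattice` (family `hubbard`). For the Hubbard torus
`H_U = hubbardTorus 2 L 1 U` in the joint sector `K_L = szSector N_L 0`, `N_L = 2⌊(1-δ)L²/2⌋`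
(hole doping `δ`), we PROVE a VOLUME-UNIFORM, strictly positive lower bound on the interaction part of
the sector ground energy:

* `hubbardTorus_holeCounting_floor` — the hole/doublon counting floor of `HubbardHoleCountingBound`
  on the torus (degree `4`, `t = 1`): `minEnergyOn H_U K_L ≥ -4(L² - N_L) - 4ωL²` for `U ≥ 8 + 8/ω`;
* `minEnergyOn_hubbardTorus_zero_szSector_le` — a free CEILING by an explicit trial Fermi set: fill the
  lattice diamond `m(k₀) + m(k₁) ≤ ⌊L/4⌋` (`≥ 2⌊L/4⌋²` levels, each `≤ -4cos²(π/4) = -2`,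
  `TorusBandEdgeCounting`) and complete inside the diamond `m(k₀) + m(k₁) ≤ ⌊(L-1)/2⌋` (levels `≤ 0`):
  `minEnergyOn H_0 K_L ≤ -8⌊L/4⌋²` for `L ≥ 4/δ`, `L ≥ 8`, `0 < δ < 1/8`;
* `minEnergyOn_hubbardTorus_convex_coupling` — concavity in the coupling:
  `θ·minE(H_{U₁}|K) + (1-θ)·minE(H_0|K) ≤ minE(H_{θU₁}|K)` (`0 ≤ θ ≤ 1`);
* **`hubbardTorus_repulsion_gap`** — for `0 < δ < 1/8` and EVERY `U > 0` there are `c > 0` and `L₀`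
  with `minEnergyOn H_U K_L - minEnergyOn H_0 K_L ≥ c L²` for all `L ≥ L₀`: the repulsion raises the
  ground-state energy per site by at least `c(U, δ) = min(1, U/U₁)·(1/2 - 4δ)/8`,
  `U₁ = 8 + 128/(1 - 8δ)`. (With the exact free value `e₀(1-δ) = -16/π² + O(δ)` in place of the trial
  ceiling `-1/2` the same argument covers `δ < 2/π² ≈ 0.2`; the doping range is limited only by the
  crude trial set used here.)

Context: this is the on-site (`s`-wave) analogue of the "local pair repulsion raises the energy density"
clause of the parabolic-descent line for the crux `KacWindowPenalty.WindowGap` of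
`Summits/HubbardSuperconductivity` and sharpens the interaction budget of its witnesses
(`Theorems/WindowGap/Negative/InteractionBudget.lean`: `E_U ≥ E_0` is replaced by `E_U ≥ E_0 + cL²`).
Everything is proved; no definition and no named fact. [folklore] (Y. Nagaoka, Phys. Rev. 147 (1966) 392,
§II; W. F. Brinkman, T. M. Rice, Phys. Rev. B 2 (1970) 1324, §II, for the hole bandwidth `z t`.)

## Mathlib / tree search

Tree (REUSED): `holeCounting_le_minEnergyOn_szSector` (`HubbardHoleCountingBound`),
`card_filter_fermionTorusGraph_adj_le` (`HubbardLSMFillingProofs`), `minEnergyOn_szSector_hubbardTorus_zero_le`,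
`pairedState_mem_szSector`, `star_pairedState_dotProduct_self` (`FreeFermionSectorEnergyDeviation`,
`PairedProductStates`), `torusBand_le_of_folded_sum_le`, `two_mul_sq_le_card_diamond`
(`TorusBandEdgeCounting`), `minEnergyOn_le_rayleigh_of_mem`, `LiebThm1.hamiltonian_isHermitian`.
Mathlib: `Finset.exists_subsuperset_card_eq`, `Finset.exists_subset_card_eq`, `Real.cos_pi_div_four`,
`Real.cos_le_cos_of_nonneg_of_le_pi`, `Nat.floor_le`, `Nat.lt_floor_add_one`, `le_csInf`.
-/

noncomputable section

namespace Literature.MathematicalPhysics.QuantumLattice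

open Matrix Finset Literature.Probability.LatticeModels

variable {L : ℕ} [NeZero L]

/-! ### The interacting floor on the torus -/

/-- **Hole counting floor on the torus.** For `ω > 0`, `U ≥ 8 + 8ω⁻¹` and a nonempty joint sector
`(N, S^z = M)` of the Hubbard torus (`t = 1`): `minEnergyOn H_U (szSector N M) ≥ -4(L² - N) - 4ωL²`.
[folklore] -/
theorem hubbardTorus_holeCounting_floor {U ω : ℝ} (hω : 0 < ω) (hU : 8 + 8 * ω⁻¹ ≤ U) (N : ℕ) (M : ℝ)
    (hK : ∃ ψ ∈ szSector (Λ := FermionTorus 2 L) N M, star ψ ⬝ᵥ ψ = 1) :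
    -(4 * ((L : ℝ) ^ 2 - N) + 4 * ω * (L : ℝ) ^ 2) ≤
      (hubbardTorus 2 L 1 U).minEnergyOn (szSector N M) := by
  have hΔ : ∀ v : FermionTorus 2 L,
      (Finset.univ.filter ((fermionTorusGraph 2 L).Adj v)).card ≤ 4 := fun v =>
    card_filter_fermionTorusGraph_adj_le v
  have hU' : |(1 : ℝ)| * (4 : ℕ) * (2 + 2 * ω⁻¹) ≤ U := by
    rw [abs_one, one_mul]; push_cast; linarith
  have h := holeCounting_le_minEnergyOn_szSector (fermionTorusGraph 2 L) hΔ hω hU' N M hK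
  have hcard : Fintype.card (FermionTorus 2 L) = L ^ 2 := by simp [FermionTorus, Fintype.card_lex]
  rw [hubbardTorus]
  rw [hcard, abs_one, one_mul] at h
  push_cast at h
  linarith

/-! ### The free ceiling by a trial Fermi set -/

/-- **Free ceiling.** For `0 < δ < 1/8`, `L ≥ 8` and `δ L ≥ 4`, the free sector floor at
`N_L = 2⌊(1-δ)L²/2⌋` is at most `-8⌊L/4⌋²`: fill the diamond `m(k₀)+m(k₁) ≤ ⌊L/4⌋` (levels `≤ -2`) and
complete the Fermi set inside the diamond `m(k₀)+m(k₁) ≤ ⌊(L-1)/2⌋` (levels `≤ 0`). [folklore] -/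
theorem minEnergyOn_hubbardTorus_zero_szSector_le {δ : ℝ} (hδ0 : 0 < δ) (hδ : δ < 1 / 8)
    (hL8 : 8 ≤ L) (hLδ : 4 ≤ δ * L) :
    (hubbardTorus 2 L 1 0).minEnergyOn
        (szSector (Λ := FermionTorus 2 L) (2 * ⌊(1 - δ) * (L : ℝ) ^ 2 / 2⌋₊) 0) ≤
      -8 * ((L / 4 : ℕ) : ℝ) ^ 2 := by
  classical
  have hL3 : 3 ≤ L := le_trans (by norm_num) hL8
  have hLpos : (0 : ℝ) < L := by exact_mod_cast (lt_of_lt_of_le (by norm_num) hL8 : 0 < L)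
  set n : ℕ := ⌊(1 - δ) * (L : ℝ) ^ 2 / 2⌋₊ with hn
  set M₁ : ℕ := L / 4 with hM₁
  set M₂ : ℕ := (L - 1) / 2 with hM₂
  have hM₁L : 2 * M₁ < L := by omega
  have hM₂L : 2 * M₂ < L := by omega
  have hM₁₂ : M₁ ≤ M₂ := by omega
  set fold : TorusSite 2 L → ℕ := fun k => min (k 0).val (L - (k 0).val) + min (k 1).val (L - (k 1).val)
    with hfold
  set D₁ : Finset (TorusSite 2 L) := Finset.univ.filter fun k => fold k ≤ M₁ with hD₁
  set D₂ : Finset (TorusSite 2 L) := Finset.univ.filter fun k => fold k ≤ M₂ with hD₂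
  have hD₁₂ : D₁ ⊆ D₂ := fun k hk => by
    rw [hD₁, Finset.mem_filter] at hk
    rw [hD₂, Finset.mem_filter]
    exact ⟨hk.1, hk.2.trans hM₁₂⟩
  -- level bounds on the two diamonds
  have hlev₁ : ∀ k ∈ D₁, torusBand L k ≤ -2 := by
    intro k hk
    rw [hD₁, Finset.mem_filter] at hk
    have h := torusBand_le_of_folded_sum_le hM₁L k hk.2
    have hcos : Real.cos (Real.pi / 4) ≤ Real.cos (Real.pi * M₁ / L) := by
      apply Real.cos_le_cos_of_nonneg_of_le_pi
      · positivity
      · linarith [Real.pi_pos]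
      · rw [mul_div_assoc]
        have hq : (M₁ : ℝ) / L ≤ 1 / 4 := by
          rw [div_le_div_iff₀ hLpos (by norm_num : (0:ℝ) < 4)]
          have : (M₁ : ℝ) * 4 ≤ L := by
            have h4 : M₁ * 4 ≤ L := by omega
            exact_mod_cast h4
          linarith
        calc Real.pi * ((M₁ : ℝ) / L) ≤ Real.pi * (1 / 4) :=
              mul_le_mul_of_nonneg_left hq Real.pi_pos.le
          _ = Real.pi / 4 := by ring
    rw [Real.cos_pi_div_four] at hcos
    have hsq : (1 : ℝ) / 2 ≤ Real.cos (Real.pi * M₁ / L) ^ 2 := by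
      have hs : Real.sqrt 2 ^ 2 = 2 := Real.sq_sqrt (by norm_num)
      have h0 : 0 ≤ Real.sqrt 2 / 2 := by positivity
      nlinarith [hcos, h0, hs]
    linarith
  have hlev₂ : ∀ k ∈ D₂, torusBand L k ≤ 0 := by
    intro k hk
    rw [hD₂, Finset.mem_filter] at hk
    have h := torusBand_le_of_folded_sum_le hM₂L k hk.2
    have : 0 ≤ Real.cos (Real.pi * M₂ / L) ^ 2 := sq_nonneg _
    linarith
  -- cardinalities
  have hcard₁ : 2 * M₁ ^ 2 ≤ D₁.card := two_mul_sq_le_card_diamond hM₁L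
  have hcard₂ : 2 * M₂ ^ 2 ≤ D₂.card := two_mul_sq_le_card_diamond hM₂L
  have hn_le : n ≤ D₂.card := by
    -- `n ≤ (1-δ)L²/2 ≤ (L-2)²/2 ≤ 2 M₂²`
    refine le_trans ?_ hcard₂
    have h1 : (n : ℝ) ≤ (1 - δ) * (L : ℝ) ^ 2 / 2 := Nat.floor_le (by nlinarith)
    have h2 : (1 - δ) * (L : ℝ) ^ 2 / 2 ≤ ((L : ℝ) - 2) ^ 2 / 2 := by nlinarith
    have h3 : ((L : ℝ) - 2) ^ 2 / 2 ≤ (2 * M₂ ^ 2 : ℕ) := by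
      have hM : (L : ℝ) - 2 ≤ 2 * (M₂ : ℝ) := by
        have : L - 2 ≤ 2 * M₂ := by omega
        have hL2 : (2 : ℕ) ≤ L := by omega
        have := (Nat.cast_le (α := ℝ)).2 this
        rw [Nat.cast_sub hL2] at this
        push_cast at this
        linarith
      have hL2' : (0 : ℝ) ≤ (L : ℝ) - 2 := by
        have : (8 : ℝ) ≤ L := by exact_mod_cast hL8
        linarith
      push_cast
      nlinarith
    exact_mod_cast (h1.trans (h2.trans h3))
  -- the trial Fermi set
  obtain ⟨F, hFcard, hFsum⟩ : ∃ F : Finset (TorusSite 2 L), F.card = n ∧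
      ∑ k ∈ F, torusBand L k ≤ -2 * (2 * M₁ ^ 2 : ℕ) := by
    by_cases hcase : D₁.card ≤ n
    · obtain ⟨F, hF₁, hF₂, hFc⟩ := Finset.exists_subsuperset_card_eq hD₁₂ hcase hn_le
      refine ⟨F, hFc, ?_⟩
      rw [← Finset.sum_sdiff hF₁]
      have hA : ∑ k ∈ F \ D₁, torusBand L k ≤ 0 :=
        Finset.sum_nonpos fun k hk => hlev₂ k (hF₂ (Finset.mem_sdiff.1 hk).1)
      have hB : ∑ k ∈ D₁, torusBand L k ≤ ∑ _k ∈ D₁, (-2 : ℝ) := Finset.sum_le_sum hlev₁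
      rw [Finset.sum_const, nsmul_eq_mul] at hB
      have hC : ((2 * M₁ ^ 2 : ℕ) : ℝ) ≤ D₁.card := by exact_mod_cast hcard₁
      push_cast at hC ⊢
      nlinarith
    · push Not at hcase
      obtain ⟨F, hF₁, hFc⟩ := Finset.exists_subset_card_eq hcase.le
      refine ⟨F, hFc, ?_⟩
      have hB : ∑ k ∈ F, torusBand L k ≤ ∑ _k ∈ F, (-2 : ℝ) :=
        Finset.sum_le_sum fun k hk => hlev₁ k (hF₁ hk)
      rw [Finset.sum_const, nsmul_eq_mul, hFc] at hB
      -- `2 M₁² ≤ n`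
      have hC : ((2 * M₁ ^ 2 : ℕ) : ℝ) ≤ n := by
        have h1 : ((n : ℕ) : ℝ) > (1 - δ) * (L : ℝ) ^ 2 / 2 - 1 := by
          have := Nat.lt_floor_add_one ((1 - δ) * (L : ℝ) ^ 2 / 2)
          rw [← hn] at this
          linarith
        have h2 : (M₁ : ℝ) * 4 ≤ L := by
          have h4 : M₁ * 4 ≤ L := by omega
          exact_mod_cast h4
        have hL' : (8 : ℝ) ≤ L := by exact_mod_cast hL8
        push_cast
        nlinarith
      push_cast at hC ⊢
      nlinarith
  have h := minEnergyOn_szSector_hubbardTorus_zero_le hL3 F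
  rw [hFcard] at h
  refine h.trans ?_
  push_cast at hFsum ⊢
  nlinarith

/-! ### Concavity in the coupling and the repulsion gap -/

omit [NeZero L] in
/-- The quadratic form of `H_U` is affine in `U`. [folklore] -/
theorem re_expect_hubbardTorus_eq (U : ℝ) (ψ : Fock (Orb (FermionTorus 2 L))) :
    (star ψ ⬝ᵥ (hubbardTorus 2 L 1 U *ᵥ ψ)).re =
      (star ψ ⬝ᵥ (hubbardTorus 2 L 1 0 *ᵥ ψ)).re +
        U * (star ψ ⬝ᵥ ((∑ x : FermionTorus 2 L, numberOp x 0 * numberOp x 1) *ᵥ ψ)).re := by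
  -- `H_U = H_0 + U · Σ_x n_{x↑}n_{x↓}` (cf. `hubbardTorus_eq_zero_add_smul_interaction`)
  have hsplit : hubbardTorus 2 L 1 U = hubbardTorus 2 L 1 0 +
      (U : ℂ) • ∑ x : FermionTorus 2 L, numberOp x 0 * numberOp x 1 := by
    simp only [hubbardTorus, hamiltonian, Complex.ofReal_zero, zero_smul, add_zero]
  rw [hsplit, add_mulVec, smul_mulVec, dotProduct_add, dotProduct_smul,
    Complex.add_re, smul_eq_mul, Complex.re_ofReal_mul]

omit [NeZero L] in
/-- **Concavity of the sector floor in the coupling.** For `0 ≤ θ ≤ 1` and a nonempty sector `K`: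
`θ·minE(H_{U₁}|K) + (1-θ)·minE(H_0|K) ≤ minE(H_{θU₁}|K)` (an infimum of affine functions of `U` is
concave). [folklore] -/
theorem minEnergyOn_hubbardTorus_convex_coupling {θ : ℝ} (hθ0 : 0 ≤ θ) (hθ1 : θ ≤ 1) (U₁ : ℝ)
    (K : Submodule ℂ (Fock (Orb (FermionTorus 2 L)))) (hK : ∃ ψ ∈ K, star ψ ⬝ᵥ ψ = 1) :
    θ * (hubbardTorus 2 L 1 U₁).minEnergyOn K + (1 - θ) * (hubbardTorus 2 L 1 0).minEnergyOn K ≤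
      (hubbardTorus 2 L 1 (θ * U₁)).minEnergyOn K := by
  classical
  obtain ⟨ψ₀, hψ₀K, hψ₀⟩ := hK
  refine le_csInf ⟨_, ψ₀, hψ₀K, hψ₀, rfl⟩ ?_
  rintro E ⟨ψ, hψK, hψ1, rfl⟩
  have h1 := minEnergyOn_le_rayleigh_of_mem (LiebThm1.hamiltonian_isHermitian (fermionTorusGraph 2 L) 1 U₁)
    K hψK hψ1
  have h0 := minEnergyOn_le_rayleigh_of_mem (LiebThm1.hamiltonian_isHermitian (fermionTorusGraph 2 L) 1 0)
    K hψK hψ1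
  rw [← hubbardTorus] at h1 h0
  rw [re_expect_hubbardTorus_eq (θ * U₁) ψ]
  rw [re_expect_hubbardTorus_eq U₁ ψ] at h1
  have h1' := mul_le_mul_of_nonneg_left h1 hθ0
  have h0' := mul_le_mul_of_nonneg_left h0 (sub_nonneg.2 hθ1)
  nlinarith [h1', h0']

/-- A unit vector of the sector `(2n, S^z = 0)` for `n ≤ L²` (a paired Fermi sea). [folklore] -/
theorem exists_unit_mem_szSector_two_mul {n : ℕ} (hn : n ≤ L ^ 2) :
    ∃ ψ ∈ szSector (Λ := FermionTorus 2 L) (2 * n) 0, star ψ ⬝ᵥ ψ = 1 := by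
  classical
  have hcard : n ≤ (Finset.univ : Finset (TorusSite 2 L)).card := by
    rw [Finset.card_univ]
    simpa [TorusSite, Fintype.card_fun, ZMod.card] using hn
  obtain ⟨F, -, hF⟩ := Finset.exists_subset_card_eq hcard
  refine ⟨(List.map (fun k : TorusSite 2 L => (pairMode k)ᴴ) F.toList).prod *ᵥ
    (vacuum : Fock (Orb (FermionTorus 2 L))), ?_, star_pairedState_dotProduct_self F.nodup_toList⟩
  have h := pairedState_mem_szSector F.toList
  rwa [Finset.length_toList, hF] at h

/-- **The repulsion gap.** For hole doping `0 < δ < 1/8` and every `U > 0` there are `c > 0` and `L₀`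
such that for all `L ≥ L₀`, in the sector `(N_L, S^z = 0)`, `N_L = 2⌊(1-δ)L²/2⌋`, of the Hubbard torus
(`t = 1`): `minEnergyOn H_U - minEnergyOn H_0 ≥ c L²` — the on-site repulsion raises the ground-state
energy DENSITY strictly, uniformly in the volume (`c = min(1, U/U₁)(1/2 - 4δ)/4`, `U₁ = 8 + 128/(1-8δ)`).
[folklore] -/
theorem hubbardTorus_repulsion_gap {δ : ℝ} (hδ0 : 0 < δ) (hδ : δ < 1 / 8) {U : ℝ} (hU : 0 < U) :
    ∃ c : ℝ, 0 < c ∧ ∃ L₀ : ℕ, ∀ (L : ℕ) [NeZero L], L₀ ≤ L →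
      c * (L : ℝ) ^ 2 ≤
        (hubbardTorus 2 L 1 U).minEnergyOn
            (szSector (Λ := FermionTorus 2 L) (2 * ⌊(1 - δ) * (L : ℝ) ^ 2 / 2⌋₊) 0) -
          (hubbardTorus 2 L 1 0).minEnergyOn
            (szSector (Λ := FermionTorus 2 L) (2 * ⌊(1 - δ) * (L : ℝ) ^ 2 / 2⌋₊) 0) := by
  -- constants
  set m : ℝ := 1 / 2 - 4 * δ with hm
  have hm0 : 0 < m := by rw [hm]; linarith
  have hm1 : m ≤ 1 / 2 := by rw [hm]; linarith
  set ω : ℝ := m / 8 with hω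
  have hω0 : 0 < ω := by positivity
  set U₁ : ℝ := 8 + 8 * ω⁻¹ with hU₁
  have hU₁0 : 0 < U₁ := by positivity
  set θ : ℝ := min 1 (U / U₁) with hθ
  have hθ0 : 0 < θ := lt_min one_pos (div_pos hU hU₁0)
  have hθ1 : θ ≤ 1 := min_le_left _ _
  refine ⟨θ * (m / 4), by positivity, max ⌈14 / m⌉₊ (max ⌈4 / δ⌉₊ 8), ?_⟩
  intro L _ hL
  -- unpack `L ≥ L₀`
  have hL14 : 14 / m ≤ L := (Nat.ceil_le.1 (le_trans (le_max_left _ _) hL))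
  have hL4δ : 4 / δ ≤ L := (Nat.ceil_le.1 (le_trans ((le_max_left _ _).trans (le_max_right _ _)) hL))
  have hL8 : 8 ≤ L := le_trans ((le_max_right _ _).trans (le_max_right _ _)) hL
  have hLr : (8 : ℝ) ≤ L := by exact_mod_cast hL8
  have hLδ : 4 ≤ δ * L := by
    rw [div_le_iff₀ hδ0] at hL4δ; linarith
  have hLm : 14 ≤ m * L := by
    rw [div_le_iff₀ hm0] at hL14; linarith
  set n : ℕ := ⌊(1 - δ) * (L : ℝ) ^ 2 / 2⌋₊ with hn
  set K := szSector (Λ := FermionTorus 2 L) (2 * n) 0 with hKdef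
  -- the sector is nonempty
  have hnL : n ≤ L ^ 2 := by
    have h1 : (n : ℝ) ≤ (1 - δ) * (L : ℝ) ^ 2 / 2 := Nat.floor_le (by nlinarith)
    have h2 : (1 - δ) * (L : ℝ) ^ 2 / 2 ≤ (L : ℝ) ^ 2 := by nlinarith
    exact_mod_cast h1.trans h2
  have hK : ∃ ψ ∈ K, star ψ ⬝ᵥ ψ = 1 := exists_unit_mem_szSector_two_mul hnL
  -- free ceiling and the gap at couplings `U' ≥ U₁`
  have hfree : (hubbardTorus 2 L 1 0).minEnergyOn K ≤ -8 * ((L / 4 : ℕ) : ℝ) ^ 2 :=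
    minEnergyOn_hubbardTorus_zero_szSector_le hδ0 hδ hL8 hLδ
  have hgap : ∀ U' : ℝ, U₁ ≤ U' →
      m / 4 * (L : ℝ) ^ 2 ≤ (hubbardTorus 2 L 1 U').minEnergyOn K - (hubbardTorus 2 L 1 0).minEnergyOn K := by
    intro U' hU'
    have hfl := hubbardTorus_holeCounting_floor (U := U') hω0 (hU₁.ge.trans hU') (2 * n) 0 hK
    rw [← hKdef] at hfl
    -- `2n ≥ (1-δ)L² - 2`
    have hn1 : (1 - δ) * (L : ℝ) ^ 2 / 2 - 1 < n := by
      have := Nat.lt_floor_add_one ((1 - δ) * (L : ℝ) ^ 2 / 2)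
      rw [← hn] at this
      linarith
    -- `⌊L/4⌋ ≥ (L-3)/4`
    have hM : ((L : ℝ) - 3) / 4 ≤ ((L / 4 : ℕ) : ℝ) := by
      have h4 : L - 3 ≤ (L / 4) * 4 := by omega
      have hL3 : (3 : ℕ) ≤ L := by omega
      have := (Nat.cast_le (α := ℝ)).2 h4
      rw [Nat.cast_sub hL3] at this
      push_cast at this
      linarith
    have hM0 : (0 : ℝ) ≤ ((L : ℝ) - 3) / 4 := by linarith
    have hM2 : (((L : ℝ) - 3) / 4) ^ 2 ≤ (((L / 4 : ℕ) : ℝ)) ^ 2 := pow_le_pow_left₀ hM0 hM 2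
    push_cast at hfl
    rw [hω] at hfl
    nlinarith [hfl, hfree, hn1, hM2, hLm, hm1]
  by_cases hcase : U₁ ≤ U
  · -- strong coupling: hole counting applies directly
    have h := hgap U hcase
    have hθm : θ * (m / 4) * (L : ℝ) ^ 2 ≤ m / 4 * (L : ℝ) ^ 2 := by
      have : θ * (m / 4) ≤ 1 * (m / 4) := mul_le_mul_of_nonneg_right hθ1 (by positivity)
      nlinarith
    exact hθm.trans h
  · -- weak coupling: concavity in `U` transports the gap at `U₁`
    push Not at hcase
    have hθU : θ = U / U₁ := min_eq_right (div_le_one_of_le₀ hcase.le hU₁0.le)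
    have hθU' : θ * U₁ = U := by rw [hθU]; field_simp
    have hconv := minEnergyOn_hubbardTorus_convex_coupling hθ0.le hθ1 U₁ K hK
    rw [hθU'] at hconv
    have h := hgap U₁ le_rfl
    have h' := mul_le_mul_of_nonneg_left h hθ0.le
    nlinarith [hconv, h']

end Literature.MathematicalPhysics.QuantumLattice
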